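import Literature.MathematicalPhysics.QuantumFieldTheory.Balaban1983to89.B9Eq335RegularityClasses
import Literature.MathematicalPhysics.QuantumFieldTheory.Balaban1983to89.B10Eq27TorusAxialLog
import Literature.MathematicalPhysics.QuantumFieldTheory.Balaban1983to89.LatticeFieldCalculus

/-!
# `Balaban1983to89.B11Reg910Classes` — [Balaban1985Variational] Theorem 1 (9)–(10) p. 279: the REGULARITY CLASS of a minimal configuration on one
# cube «there exists a gauge transformation u … on □, U^{u⁻¹} = e^{iηA}, |A| < B₃Mε₁(Lʲη)⁻¹, |∇^ηA| < B₃Mε₁(Lʲη)⁻², ‖A‖_{1,β} < B₄(β₀)Mε₁(Lʲη)^{−2−β},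
# 0 ≦ β ≦ β₀, (9)  |∂^{η*}∂^ηA|, |Δ^ηA| < B₃Mε₁(Lʲη)⁻³ (10)» as a NAMED PREDICATE WITH BODY in the ∃u-form, on the SAME abstract-lattice carrier and in
# the same letters as the tree's [B9] (3.35)–(3.36) classes `B9Eq335RegularityClasses.Reg335Cube ∕ Reg336Cube` (which it extends by the Hölder member of
# (9) and the Laplacian member of (10)); its reading on NODE 00's torus of record; and the link «(9)–(10) on □ ⇒ (3.35)–(3.36) on □»

T. Bałaban, *The variational problem and background fields in renormalization group method for lattice gauge theories*, Commun. Math. Phys. **102**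
(1985) 277–309 [Balaban1985Variational] (cell paper B11), Theorem 1 (9)–(10) p. 279; Sect. F (152) p. 301 (the gauge `u` of (9)–(10) is the Landau
gauge of [Balaban1985RegularSpaces] Theorem 2 applied to the pair (U′_k, 1) on □̃); [Balaban1985BackgroundPropagators] (B9) (3.35)–(3.36) p. 396 and
(3.40) p. 397 (definition of `‖A‖_{1,β}`); [Balaban1984PropagatorsI] (B5) (1.109) p. 35 (the same Hölder seminorm); [Balaban1985RegularSpaces] (B8)
(1.36)∕(1.39) pp. 82–83 (the five members for the Landau gauge).  Cell `pub-ymgap`, seat `pub-ymgap-dag-n07-a` (gen 2) as INTERIM TYPER «def-Z» of the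
Stage-3′(Z) regularity layer (director-ym LINE №35, 2026-08-26; rails of LINE №32: Literature-side definitions, no stage predicate, no
`instance`∕`notation`, the regularity datum a parameter where print leaves a choice, veto-by-name reserved to NODE 00's successors).

WHY THIS FILE.  The Theorem-1 socket `B11Thm1CarrierT` (same seat, p417210) leaves the four norm functionals of (9)–(10) as the residual data
`RegCarrierT` because r2's carrier `B11.VarProblem` types them as functions of (U, □) alone, whereas print's `A` is the potential in ONE chosen
gauge `u` (interface finding F8: an object-level pin must fix `u` = [B8] Thm 2's unique gauge).  What CAN be typed faithfully today is print's own
∃u-SENTENCE; the tree already has exactly this sentence shape for [B9] (3.35)–(3.36) (`Reg335Cube`: «∃ u of unitary type on □, U^u = e^{iηA}, |A| < Cξ⁻¹,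
|∇^ηA| < Cξ⁻² on □»; `Reg336Cube`: + «|∂^{η*}∂^ηA| < Cξ⁻³»), on the pv27 abstract lattice (sites `S`, directions `ι`, shifts `T : ι → Equiv.Perm S`,
values in the units of a Banach algebra `𝔸`; `B9Eq39Adjoint.covD ∕ covDstar ∕ curlη ∕ divPη ∕ fluct`, `B9Eq3117Current.gaugeTr`).  [B11] (9)–(10) is
that sentence with two more members and the constants `C = B₃Mε₁`, `C₄ = B₄(β₀)Mε₁` at the cube's scale `ξ = Lʲη` — typed here VERBATIM, so that
«U_k satisfies (3.35)–(3.36) of [5]» (the form in which [B11] Prop. 9 p. 309 and [B12] consume Theorem 1's regularity) is one projection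
(`Reg910Cube.reg336Cube`).

WHAT IS DEFINED (bodies; cite-don't-restate: the (3.35)–(3.36) members ARE r06's letters).
* `lapη T U η f` — the covariant bond Laplacian `Δ^η_U f := Σ_ν η⁻² D^{1*}_{U,ν} D¹_{U,ν} f` (DECLARED READING D-n07a-3: [B8] (1.39) ∕ [B11] (10) display the
  member `|Δ^η A|` but not the operator's formula on those pages; the `D*D` form of [B5] §1 is taken — only its NORM enters (10), so the sign convention is
  immaterial); used at the flat background `U = 1` in (10).
* **`Reg910Cube T U η □ ξ dist C C₄ β₀`** — [B11] (9)–(10) ON ONE CUBE in the ∃u-form: `u` of unitary type on □, `U^u = e^{iηA}` on □ (print writes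
  `U^{u⁻¹}`; `∃ u ⟺ ∃ u⁻¹`), and on □: `|A| < Cξ⁻¹`, `|∇^ηA| < Cξ⁻²` (flat `∇^η = η⁻¹D¹` — the background of (152) is `1`), the HÖLDER member «`‖A‖_{1,β} <
  C₄ ξ^{−2−β}` for `0 ≦ β ≦ β₀`» in the pointwise strict form of the finite supremum (3.40) = (1.109) «‖A‖_{1,β} = ‖∇A‖_β = max_{μ,ν} sup_{x,x′: |x−x′| ≦ 1}
  |x − x′|^{−β}|…(D_μA_ν)(x′) − (D_μA_ν)(x)|» at flat transport, with the η-scale distance `dist : S → S → ℝ` a PARAMETER of the abstract lattice (DECLARED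
  READING D-n07a-4: on the torus of record `dist` is the η-scale lattice distance; print's «shortest contour» transport is `1` at the flat background),
  `|∂^{η*}∂^ηA| < Cξ⁻³` (r06's letters `divPη ∘ curlη` at `U = 1`), `|Δ^ηA| < Cξ⁻³` (`lapη` at `U = 1`).  Dictionary: `C = B₃Mε₁`, `C₄ = B₄(β₀)Mε₁`,
  `ξ = Lʲη` for a cube of size `2MLʲη` and index `j`.
* `Reg910 T U η L 𝒬 dist C C₄ β₀` — the class: (9)–(10) on every cube of an indexed family `𝒬` (the cube class of [Balaban1984PropagatorsII] Sect. F ∕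
  [B11] p. 279 «in the class described above» enters as a parameter, r06's pattern).
* `toPV U`, **`Reg910T F N K k U □ j dist C C₄ β₀`** — the same predicate READ ON NODE 00's TORUS OF RECORD: directions `Fin (F.P K).d`, sites
  `Site (F.P K) 0`, shifts `LatticeFieldCalculus.shiftEquiv`, an `SU(N)` configuration read in `M_N(ℂ)ˣ` (`B10Eq27TorusAxialLog.unitsField ∘ toUField`),
  `η = η_k = (F.P K).eta k`, `ξ = Lʲη_k` (`LatticeNorms.scaleLen`).

WHAT IS PROVED (kernel; 0 sorry).  `Reg910Cube.reg336Cube` ∕ `.reg335Cube` ([B11] (9)–(10) on □ ⇒ [B9] (3.35)–(3.36) ∕ (3.35) on □ with `O(1)Mα₀ := C`),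
`Reg910.reg336` ∕ `.reg335`; `Reg910Cube.mono` (monotone in `C`, `C₄` for `ξ > 0`); **`reg910Cube_one`** (the trivial configuration `U ≡ 1` is in the class
for every cube, all `C, C₄ > 0`, `ξ > 0` — `u = 1`, `A = 0`; the ∀-form non-vacuity guard); `reg910_one`; `toPV_one`, **`reg910T_one`** (the same on the
torus of record).

HONEST FRAMING: definitions with bodies + kernel bookkeeping; NOTHING of Bałaban's is asserted (that minimal configurations satisfy (9)–(10) is [B11]
Thm 1 ∕ Sect. F, proved nowhere in the tree); `B11Thm1CarrierT.RegCarrierT` is NOT pinned here (F8: it needs a fixed gauge); count-neutral; N07 NOT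
discharged; one finite four-torus programme at fixed `ε`; nothing continuum ∕ ℝ⁴ ∕ OS ∕ mass-gap ∕ Clay.
-/

noncomputable section

open scoped Matrix.Norms.L2Operator

namespace Literature.MathematicalPhysics.QuantumFieldTheory.Balaban1983to89.B11Reg910Classes

open Complex
open B9Eq39Adjoint (R covD covDstar curlη divPη fluct)
open B9Eq3117Current (gaugeTr)
open B9Eq335RegularityClasses (Reg335Cube Reg336Cube Reg335 Reg336)
open LatticeNorms (scaleLen)

/-! ## §1 The bond Laplacian `Δ^η_U` (reading D-n07a-3) -/

section Lap

variable {𝔸 : Type*} [NormedRing 𝔸] [NormedAlgebra ℂ 𝔸] {S : Type*} {ι : Type*} [Fintype ι]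
variable (T : ι → Equiv.Perm S) (U : ι → S → 𝔸ˣ)

/-- **`Δ^η_U f := Σ_ν η⁻² D^{1*}_{U,ν} D¹_{U,ν} f`** on site functions (r06's `covD` (3.3) and `covDstar` (3.8) at `η = 1`, rescaled) — the operator whose
norm is the member «|Δ^η_{U₀}A|» of [B8] (1.39) and «|Δ^ηA|» of [B11] (10) (DECLARED READING D-n07a-3: the `D*D` form; only the norm is used).
[cite: Balaban1985RegularSpaces, (1.39) p.83; Balaban1985Variational, (10) p.279; Balaban1985BackgroundPropagators, (3.3) p.390, (3.8) p.392] -/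
def lapη (η : ℝ) (f : S → 𝔸) (x : S) : 𝔸 :=
  ∑ ν, (((η : ℂ)⁻¹) ^ 2) • covDstar T U ν (covD T U ν f) x

omit [NormedAlgebra ℂ 𝔸] [Fintype ι] in
/-- `D¹_{U,ν} 0 = 0`. [cite: Balaban1985BackgroundPropagators, (3.3) p.390 (bookkeeping)] -/
theorem covD_zero (ν : ι) (x : S) : covD T U ν (fun _ : S => (0 : 𝔸)) x = 0 := by
  simp [covD, R]

omit [NormedAlgebra ℂ 𝔸] [Fintype ι] in
/-- `D^{1*}_{U,ν} 0 = 0`. [cite: Balaban1985BackgroundPropagators, (3.8) p.392 (bookkeeping)] -/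
theorem covDstar_zero (ν : ι) (x : S) : covDstar T U ν (fun _ : S => (0 : 𝔸)) x = 0 := by
  simp [covDstar, R]

/-- `Δ^η_U 0 = 0`. [cite: Balaban1985RegularSpaces, (1.39) p.83 (bookkeeping)] -/
theorem lapη_zero (η : ℝ) (x : S) : lapη T U η (fun _ : S => (0 : 𝔸)) x = 0 := by
  unfold lapη
  refine Finset.sum_eq_zero fun ν _ => ?_
  have h1 : covD T U ν (fun _ : S => (0 : 𝔸)) = fun _ => 0 := funext (covD_zero T U ν)
  rw [h1, covDstar_zero, smul_zero]

end Lap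

/-! ## §2 [B11] (9)–(10) on one cube, in the ∃u-form of r06's (3.35)–(3.36) -/

section Reg

variable {𝔸 : Type*} [NormedRing 𝔸] [NormedAlgebra ℂ 𝔸] [CompleteSpace 𝔸] {S : Type*} {ι : Type*} [Fintype ι] [LinearOrder ι]
variable (T : ι → Equiv.Perm S) (U : ι → S → 𝔸ˣ)

/-- **[B11] THEOREM 1 (9)–(10) ON ONE CUBE □ of index `j`, scale `ξ = Lʲη`, constants `C = B₃Mε₁`, `C₄ = B₄(β₀)Mε₁`**, in the ∃u-form: «there exists a
gauge transformation u … on □, U^{u⁻¹} = e^{iηA}» (`u` of unitary type on □, `U^u` = `gaugeTr` (3.28), `e^{iηA}` = `fluct`; `∃u ⟺ ∃u⁻¹`) and on □: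
«|A| < B₃Mε₁(Lʲη)⁻¹, |∇^ηA| < B₃Mε₁(Lʲη)⁻²» (flat `∇^η = η⁻¹D¹`), «‖A‖_{1,β} < B₄(β₀)Mε₁(Lʲη)^{−2−β}, 0 ≦ β ≦ β₀» (the finite supremum (3.40)∕(1.109) in
pointwise strict form over pairs `z, z′ ∈ □` with `0 < dist z z′ ≦ 1`, `dist` the η-scale distance — a parameter, reading D-n07a-4), «|∂^{η*}∂^ηA| <
B₃Mε₁(Lʲη)⁻³» (`divPη ∘ curlη` at `U = 1`), «|Δ^ηA| < B₃Mε₁(Lʲη)⁻³» (`lapη` at `U = 1`).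
[cite: Balaban1985Variational, (9)–(10) p.279; Balaban1985BackgroundPropagators, (3.40) p.397; Balaban1984PropagatorsI, (1.109) p.35] -/
def Reg910Cube (η : ℝ) (cube : Set S) (ξ : ℝ) (dist : S → S → ℝ) (C C₄ β₀ : ℝ) : Prop :=
  ∃ (u : S → 𝔸ˣ) (A : ι → S → 𝔸),
    (∀ z ∈ cube, ‖(u z : 𝔸)‖ ≤ 1 ∧ ‖(((u z)⁻¹ : 𝔸ˣ) : 𝔸)‖ ≤ 1) ∧
    (∀ κ, ∀ z ∈ cube, gaugeTr T u U κ z = fluct η A κ z) ∧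
    (∀ κ, ∀ z ∈ cube, ‖A κ z‖ < C * ξ⁻¹) ∧
    (∀ κ ν, ∀ z ∈ cube, ‖((η : ℂ)⁻¹) • covD T (fun _ _ => (1 : 𝔸ˣ)) κ (A ν) z‖ < C * (ξ ^ 2)⁻¹) ∧
    (∀ β : ℝ, 0 ≤ β → β ≤ β₀ → ∀ κ ν, ∀ z ∈ cube, ∀ z' ∈ cube, 0 < dist z z' → dist z z' ≤ 1 →
      ‖((η : ℂ)⁻¹) • covD T (fun _ _ => (1 : 𝔸ˣ)) κ (A ν) z' - ((η : ℂ)⁻¹) • covD T (fun _ _ => (1 : 𝔸ˣ)) κ (A ν) z‖ <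
        C₄ * (ξ ^ (2 + β))⁻¹ * dist z z' ^ β) ∧
    (∀ μ, ∀ z ∈ cube, ‖divPη T (fun _ _ => (1 : 𝔸ˣ)) η (curlη T (fun _ _ => (1 : 𝔸ˣ)) η A) μ z‖ < C * (ξ ^ 3)⁻¹) ∧
    (∀ κ, ∀ z ∈ cube, ‖lapη T (fun _ _ => (1 : 𝔸ˣ)) η (A κ) z‖ < C * (ξ ^ 3)⁻¹)

/-- **[B11] (9)–(10) on □ ⟹ [B9] (3.35)–(3.36) on □** with `O(1)Mα₀ := C` — the form in which Theorem 1's regularity is CONSUMED («U satisfying the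
regularity conditions (3.35)–(3.38) [5]», [B11] Prop. 9 p. 309; [B8] (1.33)): drop the Hölder and the Laplacian members. [cite: Balaban1985Variational, (9)–(10) p.279, Prop. 9 p.309; Balaban1985BackgroundPropagators, (3.35)–(3.36) p.396] -/
theorem Reg910Cube.reg336Cube {η : ℝ} {cube : Set S} {ξ : ℝ} {dist : S → S → ℝ} {C C₄ β₀ : ℝ}
    (h : Reg910Cube T U η cube ξ dist C C₄ β₀) : Reg336Cube T U η cube ξ C := by
  obtain ⟨u, A, hu, hg, hA, hD, -, h10, -⟩ := h
  exact ⟨u, A, hu, hg, hA, hD, h10⟩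

/-- [B11] (9) on □ ⟹ [B9] (3.35) on □. [cite: Balaban1985Variational, (9) p.279; Balaban1985BackgroundPropagators, (3.35) p.396] -/
theorem Reg910Cube.reg335Cube {η : ℝ} {cube : Set S} {ξ : ℝ} {dist : S → S → ℝ} {C C₄ β₀ : ℝ}
    (h : Reg910Cube T U η cube ξ dist C C₄ β₀) : Reg335Cube T U η cube ξ C :=
  (h.reg336Cube T U).reg335Cube T U

/-- The class grows with its two constants (`ξ > 0`). [cite: Balaban1985Variational, (9)–(10) p.279 (bookkeeping)] -/
theorem Reg910Cube.mono {η : ℝ} {cube : Set S} {ξ : ℝ} (hξ : 0 < ξ) {dist : S → S → ℝ} {C C' C₄ C₄' β₀ : ℝ} (hC : C ≤ C')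
    (hC₄ : C₄ ≤ C₄') (h : Reg910Cube T U η cube ξ dist C C₄ β₀) : Reg910Cube T U η cube ξ dist C' C₄' β₀ := by
  obtain ⟨u, A, hu, hg, hA, hD, hH, h10, hL⟩ := h
  have hm : ∀ (n : ℕ) {t : ℝ}, t < C * (ξ ^ n)⁻¹ → t < C' * (ξ ^ n)⁻¹ := fun n t ht =>
    ht.trans_le (mul_le_mul_of_nonneg_right hC (inv_nonneg.mpr (pow_nonneg hξ.le n)))
  refine ⟨u, A, hu, hg, fun κ z hz => ?_, fun κ ν z hz => hm 2 (hD κ ν z hz), fun β hβ hββ κ ν z hz z' hz' hd hd1 => ?_,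
    fun μ z hz => hm 3 (h10 μ z hz), fun κ z hz => hm 3 (hL κ z hz)⟩
  · simpa using hm 1 (by simpa using hA κ z hz)
  · refine (hH β hβ hββ κ ν z hz z' hz' hd hd1).trans_le ?_
    have h1 : 0 ≤ (ξ ^ (2 + β))⁻¹ := inv_nonneg.mpr (Real.rpow_nonneg hξ.le _)
    have h2 : 0 ≤ dist z z' ^ β := Real.rpow_nonneg hd.le _
    exact mul_le_mul_of_nonneg_right (mul_le_mul_of_nonneg_right hC₄ h1) h2

/-- **NON-VACUITY, ∀-form guard: the trivial configuration `U ≡ 1` is in the class on every cube**, for all `C, C₄ > 0`, `ξ > 0` (`u = 1`, `A = 0`; cf.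
[B8] p. 98 «the configuration … identically equal to 1 satisfies, of course, all possible regularity conditions»).
[cite: Balaban1985Variational, (9)–(10) p.279; Balaban1985RegularSpaces, p.98] -/
theorem reg910Cube_one [NormOneClass 𝔸] (η : ℝ) (cube : Set S) {ξ : ℝ} (hξ : 0 < ξ) (dist : S → S → ℝ) {C C₄ : ℝ} (hC : 0 < C)
    (hC₄ : 0 < C₄) (β₀ : ℝ) : Reg910Cube T (fun _ _ => (1 : 𝔸ˣ)) η cube ξ dist C C₄ β₀ := by
  have hcovD : ∀ κ, covD T (fun _ _ => (1 : 𝔸ˣ)) κ (fun _ : S => (0 : 𝔸)) = fun _ => 0 :=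
    fun κ => funext (covD_zero T _ κ)
  have hcurl : curlη T (fun _ _ => (1 : 𝔸ˣ)) η (fun (_ : ι) (_ : S) => (0 : 𝔸)) = fun _ _ _ => 0 := by
    funext μ ν x
    simp [curlη, B9Eq39Adjoint.curl, hcovD]
  have hdivP : ∀ μ z, divPη T (fun _ _ => (1 : 𝔸ˣ)) η (fun (_ : ι) (_ : ι) (_ : S) => (0 : 𝔸)) μ z = 0 := by
    intro μ z
    simp [divPη, B9Eq39Adjoint.divP, covDstar_zero]
  refine ⟨fun _ => 1, fun _ _ => 0, fun z _ => ?_, fun κ z _ => ?_, fun κ z _ => ?_, fun κ ν z _ => ?_,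
    fun β _ _ κ ν z _ z' _ hd _ => ?_, fun μ z _ => ?_, fun κ z _ => ?_⟩
  · simp
  · ext
    simp [gaugeTr, fluct]
  · simpa using mul_pos hC (inv_pos.mpr hξ)
  · rw [show (fun _ : S => (0 : 𝔸)) = fun _ => 0 from rfl, hcovD, smul_zero, norm_zero]
    exact mul_pos hC (inv_pos.mpr (pow_pos hξ 2))
  · rw [hcovD, smul_zero, sub_self, norm_zero]
    exact mul_pos (mul_pos hC₄ (inv_pos.mpr (Real.rpow_pos_of_pos hξ _))) (Real.rpow_pos_of_pos hd _)
  · rw [hcurl, hdivP, norm_zero]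
    exact mul_pos hC (inv_pos.mpr (pow_pos hξ 3))
  · rw [lapη_zero, norm_zero]
    exact mul_pos hC (inv_pos.mpr (pow_pos hξ 3))

/-- **THE CLASS [B11] (9)–(10)** of a configuration relative to an indexed family `𝒬` of cubes («for an arbitrary cube □ in the class described above, of a size
2MLʲη»): (9)–(10) on every cube at the scale `Lʲη` of its index — r06's `Reg336` pattern with the two extra members.
[cite: Balaban1985Variational, Thm 1 (9)–(10) p.279] -/
def Reg910 (η L : ℝ) (𝒬 : Set (Set S × ℕ)) (dist : S → S → ℝ) (C C₄ β₀ : ℝ) : Prop :=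
  ∀ q ∈ 𝒬, Reg910Cube T U η q.1 (scaleLen L η q.2) dist C C₄ β₀

/-- The class (9)–(10) is contained in r06's class (3.35)–(3.36). [cite: Balaban1985Variational, (9)–(10) p.279; Balaban1985BackgroundPropagators, (3.35)–(3.36) p.396] -/
theorem Reg910.reg336 {η L : ℝ} {𝒬 : Set (Set S × ℕ)} {dist : S → S → ℝ} {C C₄ β₀ : ℝ} (h : Reg910 T U η L 𝒬 dist C C₄ β₀) :
    Reg336 T U η L 𝒬 C :=
  fun q hq => (h q hq).reg336Cube T U

/-- … and in the class (3.35). [cite: Balaban1985Variational, (9) p.279; Balaban1985BackgroundPropagators, (3.35) p.396] -/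
theorem Reg910.reg335 {η L : ℝ} {𝒬 : Set (Set S × ℕ)} {dist : S → S → ℝ} {C C₄ β₀ : ℝ} (h : Reg910 T U η L 𝒬 dist C C₄ β₀) :
    Reg335 T U η L 𝒬 C :=
  (h.reg336 T U).reg335 T U

/-- The trivial configuration is in the class (9)–(10) for every cube family (`L > 0`, `η > 0`, `C, C₄ > 0`).
[cite: Balaban1985Variational, (9)–(10) p.279; Balaban1985RegularSpaces, p.98] -/
theorem reg910_one [NormOneClass 𝔸] {η L : ℝ} (hL : 0 < L) (hη : 0 < η) (𝒬 : Set (Set S × ℕ)) (dist : S → S → ℝ) {C C₄ : ℝ}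
    (hC : 0 < C) (hC₄ : 0 < C₄) (β₀ : ℝ) : Reg910 T (fun _ _ => (1 : 𝔸ˣ)) η L 𝒬 dist C C₄ β₀ :=
  fun q _ => reg910Cube_one T η q.1 (LatticeNorms.scaleLen_pos hL hη q.2) dist hC hC₄ β₀

end Reg

/-! ## §3 The reading on NODE 00's torus of record -/

section Torus

open B10Eq27TorusAxialLog (unitsField toUField)

variable {N : ℕ} [NeZero N]

/-- An `SU(N)` configuration of the `Setup` torus read on the pv27 carrier: directions `Fin P.d`, sites `Site P 0`, values in `M_N(ℂ)ˣ`
(`unitsField ∘ toUField` bond by bond). [cite: Balaban1985Averaging, (19) p.21 (the U(N) model; bookkeeping)] -/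
def toPV {P : Params} (U : GaugeField P 0 (Matrix.specialUnitaryGroup (Fin N) ℂ)) :
    Fin P.d → Site P 0 → (Matrix (Fin N) (Fin N) ℂ)ˣ :=
  fun μ x => unitsField (toUField U) ⟨x, μ⟩

/-- The trivial `SU(N)` configuration reads as the trivial pv27 configuration. [cite: Balaban1985Averaging, (19) p.21 (bookkeeping)] -/
theorem toPV_one {P : Params} : toPV (N := N) (P := P) (1 : GaugeField P 0 (Matrix.specialUnitaryGroup (Fin N) ℂ)) = fun _ _ => 1 := by
  funext μ x
  have h1 : (1 : GaugeField P 0 (Matrix.specialUnitaryGroup (Fin N) ℂ)) ⟨x, μ⟩ = 1 := rfl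
  ext i j
  simp [toPV, unitsField, toUField, h1, B10Eq27TorusAxialLog.suIncl]

end Torus

section Record

open B10Eq27TorusAxialLog (unitsField toUField)

/-- **[B11] (9)–(10) ON NODE 00's TORUS OF RECORD**: for a configuration `U` on the finest torus of the `K`-th approximation at step `k` (`η = η_k = L^{−k}`),
a cube `□ ⊂ T` of index `j` (`ξ = Lʲη_k`), the η-scale distance `dist` and the constants `C = B₃Mε₁`, `C₄ = B₄(β₀)Mε₁`.
[cite: Balaban1985Variational, Thm 1 (9)–(10) p.279] -/
def Reg910T (F : T4Continuum.T4Family) (N : ℕ) [NeZero N] (K k : ℕ) (U : GaugeField (F.P K) 0 (Matrix.specialUnitaryGroup (Fin N) ℂ))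
    (cube : Set (Site (F.P K) 0)) (j : ℕ) (dist : Site (F.P K) 0 → Site (F.P K) 0 → ℝ) (C C₄ β₀ : ℝ) : Prop :=
  Reg910Cube (fun μ => (LatticeFieldCalculus.shiftEquiv μ : Equiv.Perm (Site (F.P K) 0))) (toPV U) ((F.P K).eta k) cube
    (scaleLen (F.L : ℝ) ((F.P K).eta k) j) dist C C₄ β₀

variable {F : T4Continuum.T4Family} {N : ℕ} [NeZero N]

/-- **Non-vacuity on the torus of record**: the trivial configuration is in the class on every cube and index (`C, C₄ > 0`).
[cite: Balaban1985Variational, (9)–(10) p.279; Balaban1985RegularSpaces, p.98] -/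
theorem reg910T_one (K k : ℕ) (cube : Set (Site (F.P K) 0)) (j : ℕ) (dist : Site (F.P K) 0 → Site (F.P K) 0 → ℝ) {C C₄ : ℝ}
    (hC : 0 < C) (hC₄ : 0 < C₄) (β₀ : ℝ) :
    Reg910T F N K k (1 : GaugeField (F.P K) 0 (Matrix.specialUnitaryGroup (Fin N) ℂ)) cube j dist C C₄ β₀ := by
  letI : CStarAlgebra (Matrix (Fin N) (Fin N) ℂ) := B10Eq29TubeLine.cstarAlgebraMatrix N
  unfold Reg910T
  rw [toPV_one]
  have hL : (0 : ℝ) < F.L := by exact_mod_cast lt_trans zero_lt_one F.hL.2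
  have hη : 0 < (F.P K).eta k := pow_pos (inv_pos.mpr (Nat.cast_pos.mpr (F.P K).L_pos)) k
  exact reg910Cube_one _ _ cube (LatticeNorms.scaleLen_pos hL hη j) dist hC hC₄ β₀

end Record

end Literature.MathematicalPhysics.QuantumFieldTheory.Balaban1983to89.B11Reg910Classes
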